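import Literature.NumberTheory.GaloisRepresentations.HeckeCharacterOfGrossencharakter
import HarnessLib

/-!
# Primary generators and the algebraic Hecke character `𝔭 ↦ e(ϖ_𝔭)`

Topic `NumberTheory/GaloisRepresentations`; namespace `Literature.NumberTheory.GaloisRepresentations`.
Everything here is **proved**; there is no named fact.  Application of
`HeckeCharacter.exists_of_isGrossencharakter` (`HeckeCharacterOfGrossencharakter.lean`) to the
classical CM / Jacobi-sum Größencharaktere "`χ((α)) = α` for primary `α`".

Setting: a number field `K` whose ring of integers is principal, an ideal `𝔣` of `𝓞 K` such that
**every residue class prime to `𝔣` contains exactly one unit** —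
`hsurj : ∀ x` prime to `𝔣`, `∃ u ∈ 𝓞_Kˣ, u x ≡ 1 mod 𝔣` and `hinj : ∀ u ∈ 𝓞_Kˣ, u ≡ 1 mod 𝔣 → u = 1`
(i.e. `𝓞_Kˣ → (𝓞_K/𝔣)ˣ` is bijective; classical instances: `ℤ[ω]`, `𝔣 = (3)`, units `±ω^i` —
Ireland–Rosen Ch. 9 §3 Prop. 9.3.5, "primary" elements; `ℤ[i]`, `𝔣 = (2 + 2i)`, units `i^k`,
Ch. 9 §7), and an embedding `e : K → ℂ`.

* `primarize hsurj x` — the unit multiple `≡ 1 mod 𝔣` of an `x` prime to `𝔣` (unique: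
  `primarize_eq_of`; compatible with congruences: `primarize_mul_eq_primarize_mul`);
  `primaryGen hsurj v = ϖ_v` — THE primary generator of a prime `𝔭_v ∤ 𝔣` (`span_primaryGen`,
  `primaryGen_sub_one_mem`), and `finprod_primaryGen_pow_count`: `primarize b = ∏_v ϖ_v^{ν_v((b))}`.
* `embType e`, `embTypeConj e` — the infinity type `(p, q)` with
  `∏_w σ_w(x)^{p_w} σ̄_w(x)^{q_w} = e(x)` (`prod_embedding_zpow_embType`: `(1, 0)` at the place of `e`
  if its chosen embedding is `e`, `(0, 1)` if it is `ē`).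
* `isGrossencharakter_primaryGen` — **`𝔭 ↦ e(ϖ_𝔭)` is a Größencharakter `mod 𝔣`** of that type
  (`χ̃((b)) = e(primarize b)`), and `exists_heckeCharacter_primaryGen`: an algebraic Hecke character
  `ψ` of `K`, unramified off `𝔣`, with `ψ(ϖ_𝔭) = e(ϖ_𝔭)` — Ireland–Rosen Ch. 18 §4 (the Hecke
  character of `y² = x³ - Dx`, `y² = x³ + D`, "`χ((α)) = α`, `α` primary"), Weil 1952/1956.

The Eisenstein case `K = ℚ(ω)`, `𝔣 = (3)` (discharge of `hsurj`, `hinj` from Mathlib's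
`IsCyclotomicExtension.Rat.Three`) is `EisensteinPrimaryHeckeCharacter.lean`.

## References

* K. Ireland, M. Rosen, *A Classical Introduction to Modern Number Theory* (1982), Ch. 9 §3
  Prop. 9.3.5; Ch. 18 §4, §7. [IrelandRosen1982]
* A. Weil, *On a certain type of characters of the idèle-class group of an algebraic number-field*
  (1956), §1. [Weil1956]
* J. Neukirch, *Algebraic Number Theory* (1999), Ch. VII §6 Cor. (6.14). [NeukirchANT1999]
-/

noncomputable section

open NumberField IsDedekindDomain IsDedekindDomain.HeightOneSpectrum
open scoped ComplexConjugate

namespace Literature.NumberTheory.GaloisRepresentations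

variable {K : Type*} [Field K] [NumberField K]

/-! ### Primary elements: the unit group in bijection with `(𝓞_K/𝔣)ˣ` -/

section Primary

variable {𝔣 : Ideal (𝓞 K)}

omit [NumberField K] in
/-- If `x` is prime to `𝔣` and `x (u - 1) ∈ 𝔣` then `u - 1 ∈ 𝔣`. [folklore] -/
theorem sub_one_mem_of_mul_sub_mem {x u : 𝓞 K} (hx : IsCoprime (Ideal.span {x}) 𝔣)
    (h : x * u - x ∈ 𝔣) : u - 1 ∈ 𝔣 := by
  obtain ⟨a, ha, b, hb, hab⟩ := Submodule.mem_sup.mp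
    ((Ideal.isCoprime_iff_sup_eq.mp hx).symm ▸ Submodule.mem_top : (1 : 𝓞 K) ∈ Ideal.span {x} ⊔ 𝔣)
  obtain ⟨r, rfl⟩ := Ideal.mem_span_singleton'.mp ha
  have e : u - 1 = r * (x * u - x) + (u - 1) * b := by linear_combination (-(u - 1)) * hab
  rw [e]
  exact 𝔣.add_mem (𝔣.mul_mem_left _ h) (𝔣.mul_mem_left _ hb)

omit [NumberField K] in
/-- **Uniqueness of primary generators.**  If every unit `≡ 1 mod 𝔣` is `1`, two generators of the
same ideal which are both `≡ 1 mod 𝔣` (and prime to `𝔣`) coincide. [folklore] -/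
theorem eq_of_span_eq_of_sub_one_mem (hinj : ∀ u : (𝓞 K)ˣ, (u : 𝓞 K) - 1 ∈ 𝔣 → u = 1)
    {x y : 𝓞 K} (hx : IsCoprime (Ideal.span {x}) 𝔣) (hxy : Ideal.span {x} = Ideal.span {y})
    (hx1 : x - 1 ∈ 𝔣) (hy1 : y - 1 ∈ 𝔣) : x = y := by
  obtain ⟨u, rfl⟩ := Ideal.span_singleton_eq_span_singleton.mp hxy
  have hu : (u : 𝓞 K) - 1 ∈ 𝔣 := by
    refine sub_one_mem_of_mul_sub_mem hx ?_
    have e : x * u - x = (x * u - 1) - (x - 1) := by ring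
    rw [e]
    exact 𝔣.sub_mem hy1 hx1
  rw [hinj u hu, Units.val_one, mul_one]

/-- A maximal ideal not containing `𝔣` is prime to it (private copy of
`LFunctions.isCoprime_asIdeal_of_not_le`, which is not imported). [folklore] -/
private theorem isCoprime_asIdeal_of_not_le' {v : HeightOneSpectrum (𝓞 K)} (hv : ¬ 𝔣 ≤ v.asIdeal) :
    IsCoprime v.asIdeal 𝔣 := by
  rw [Ideal.isCoprime_iff_sup_eq]
  by_contra hne
  exact hv (le_sup_right.trans (v.isMaximal.eq_of_le hne le_sup_left).ge)

/-- In a principal `𝓞 K`, the chosen generator of `𝔭_v ∤ 𝔣` is prime to `𝔣`. [folklore] -/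
theorem isCoprime_span_generator [IsPrincipalIdealRing (𝓞 K)] {v : HeightOneSpectrum (𝓞 K)}
    (hv : ¬ 𝔣 ≤ v.asIdeal) : IsCoprime (Ideal.span {Submodule.IsPrincipal.generator v.asIdeal}) 𝔣 := by
  rw [Ideal.span_singleton_generator]
  exact isCoprime_asIdeal_of_not_le' hv

variable (hsurj : ∀ x : 𝓞 K, IsCoprime (Ideal.span {x}) 𝔣 → ∃ u : (𝓞 K)ˣ, (u : 𝓞 K) * x - 1 ∈ 𝔣)
include hsurj

omit [NumberField K] in
/-- **Primarisation**: the multiple `u x ≡ 1 mod 𝔣` of an integer `x` prime to `𝔣` by a unit `u`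
(chosen; unique under `hinj`, `primarize_eq_of`); junk value `x` when `x` is not prime to `𝔣`.
Classical instance: ℤ[ω] with `𝔣 = (3)` ("primary" Eisenstein integers, Ireland–Rosen Ch. 9 §3),
ℤ[i] with `𝔣 = (2 + 2i)`. [folklore] -/
def primarize (x : 𝓞 K) : 𝓞 K :=
  open scoped Classical in
  if hx : IsCoprime (Ideal.span {x}) 𝔣 then ((Classical.choose (hsurj x hx) : (𝓞 K)ˣ) : 𝓞 K) * x else x

omit [NumberField K] in
/-- `primarize x = u x` for a unit `u`, when `x` is prime to `𝔣`. [folklore] -/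
theorem exists_primarize_eq {x : 𝓞 K} (hx : IsCoprime (Ideal.span {x}) 𝔣) :
    ∃ u : (𝓞 K)ˣ, primarize hsurj x = u * x ∧ (u : 𝓞 K) * x - 1 ∈ 𝔣 := by
  classical
  refine ⟨Classical.choose (hsurj x hx), by rw [primarize, dif_pos hx], Classical.choose_spec (hsurj x hx)⟩

omit [NumberField K] in
/-- `primarize x ≡ 1 mod 𝔣`. [folklore] -/
theorem primarize_sub_one_mem {x : 𝓞 K} (hx : IsCoprime (Ideal.span {x}) 𝔣) :
    primarize hsurj x - 1 ∈ 𝔣 := by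
  obtain ⟨u, hu, hu1⟩ := exists_primarize_eq hsurj hx
  rw [hu]; exact hu1

omit [NumberField K] in
/-- `primarize x` generates the same ideal as `x`. [folklore] -/
theorem span_primarize {x : 𝓞 K} (hx : IsCoprime (Ideal.span {x}) 𝔣) :
    Ideal.span {primarize hsurj x} = Ideal.span {x} := by
  obtain ⟨u, hu, -⟩ := exists_primarize_eq hsurj hx
  rw [hu, mul_comm]
  exact Ideal.span_singleton_eq_span_singleton.mpr ⟨u⁻¹, Units.mul_inv_cancel_right x u⟩

omit [NumberField K] in
/-- `primarize x` is prime to `𝔣`. [folklore] -/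
theorem isCoprime_span_primarize {x : 𝓞 K} (hx : IsCoprime (Ideal.span {x}) 𝔣) :
    IsCoprime (Ideal.span {primarize hsurj x}) 𝔣 := by
  rwa [span_primarize hsurj hx]

omit [NumberField K] in
/-- **Characterisation**: any generator of `(x)` which is `≡ 1 mod 𝔣` is `primarize x`. [folklore] -/
theorem primarize_eq_of (hinj : ∀ u : (𝓞 K)ˣ, (u : 𝓞 K) - 1 ∈ 𝔣 → u = 1) {x y : 𝓞 K}
    (hx : IsCoprime (Ideal.span {x}) 𝔣) (hxy : Ideal.span {y} = Ideal.span {x}) (hy1 : y - 1 ∈ 𝔣) :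
    primarize hsurj x = y :=
  eq_of_span_eq_of_sub_one_mem hinj (isCoprime_span_primarize hsurj hx)
    ((span_primarize hsurj hx).trans hxy.symm) (primarize_sub_one_mem hsurj hx) hy1

omit [NumberField K] in
/-- **Primarisation is compatible with congruences**: if `b ≡ c mod 𝔣` are prime to `𝔣` then the same
unit primarises both, `primarize b · c = primarize c · b`. [folklore] -/
theorem primarize_mul_eq_primarize_mul (hinj : ∀ u : (𝓞 K)ˣ, (u : 𝓞 K) - 1 ∈ 𝔣 → u = 1) {b c : 𝓞 K}
    (hc : IsCoprime (Ideal.span {c}) 𝔣) (hbc : b - c ∈ 𝔣) :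
    primarize hsurj b * c = primarize hsurj c * b := by
  have hb : IsCoprime (Ideal.span {b}) 𝔣 := LFunctions.isCoprime_span_of_sub_mem hc hbc
  obtain ⟨u, hu, hu1⟩ := exists_primarize_eq hsurj hc
  have hub : primarize hsurj b = u * b := by
    refine primarize_eq_of hsurj hinj hb
      (Ideal.span_singleton_eq_span_singleton.mpr ⟨u⁻¹, by rw [mul_comm, Units.inv_mul_cancel_left]⟩) ?_
    have e : (u : 𝓞 K) * b - 1 = u * (b - c) + (u * c - 1) := by ring
    rw [e]
    exact 𝔣.add_mem (𝔣.mul_mem_left _ hbc) hu1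
  rw [hub, hu]; ring

variable [IsPrincipalIdealRing (𝓞 K)]

/-- **The primary generator `ϖ_v` of a prime `𝔭_v ∤ 𝔣`** of the principal ideal domain `𝓞 K`:
the generator `≡ 1 mod 𝔣` (`primarize` of Mathlib's `Submodule.IsPrincipal.generator`); junk at the
primes dividing `𝔣`. [folklore] -/
def primaryGen (v : HeightOneSpectrum (𝓞 K)) : 𝓞 K :=
  primarize hsurj (Submodule.IsPrincipal.generator v.asIdeal)

/-- `𝔭_v = (ϖ_v)`. [folklore] -/
theorem span_primaryGen {v : HeightOneSpectrum (𝓞 K)} (hv : ¬ 𝔣 ≤ v.asIdeal) :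
    Ideal.span {primaryGen hsurj v} = v.asIdeal := by
  rw [primaryGen, span_primarize hsurj (isCoprime_span_generator hv), Ideal.span_singleton_generator]

/-- `ϖ_v ≡ 1 mod 𝔣`. [folklore] -/
theorem primaryGen_sub_one_mem {v : HeightOneSpectrum (𝓞 K)} (hv : ¬ 𝔣 ≤ v.asIdeal) :
    primaryGen hsurj v - 1 ∈ 𝔣 :=
  primarize_sub_one_mem hsurj (isCoprime_span_generator hv)

/-- `ϖ_v ≠ 0`. [folklore] -/
theorem primaryGen_ne_zero {v : HeightOneSpectrum (𝓞 K)} (hv : ¬ 𝔣 ≤ v.asIdeal) :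
    primaryGen hsurj v ≠ 0 := fun h => v.ne_bot (by
      rw [← span_primaryGen hsurj hv, h, Ideal.span_singleton_eq_bot])

/-- **Factorisation into primary generators**: for a nonzero integer `b` prime to `𝔣`,
`primarize b = ∏_v ϖ_v^{ν_v((b))}` (both generate `(b)` and are `≡ 1 mod 𝔣`). [folklore] -/
theorem finprod_primaryGen_pow_count (hinj : ∀ u : (𝓞 K)ˣ, (u : 𝓞 K) - 1 ∈ 𝔣 → u = 1) (h𝔣 : 𝔣 ≠ ⊥)
    {b : 𝓞 K} (hb : b ≠ 0) (hcop : IsCoprime (Ideal.span {b}) 𝔣) :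
    ∏ᶠ v : HeightOneSpectrum (𝓞 K),
        primaryGen hsurj v ^ (Associates.mk v.asIdeal).count (Associates.mk (Ideal.span {b} : Ideal (𝓞 K))).factors =
      primarize hsurj b := by
  classical
  set I : Ideal (𝓞 K) := Ideal.span {b} with hI
  have hI0 : I ≠ ⊥ := (Submodule.ne_bot_iff _).mpr ⟨b, Ideal.mem_span_singleton_self b, hb⟩
  set c : HeightOneSpectrum (𝓞 K) → ℕ := fun v => (Associates.mk v.asIdeal).count (Associates.mk I).factors
    with hc
  -- at the primes in the support, `v ∣ (b)` so `v ∤ 𝔣`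
  have hvf : ∀ v : HeightOneSpectrum (𝓞 K), c v ≠ 0 → ¬ 𝔣 ≤ v.asIdeal := fun v hv hle =>
    hv (count_span_eq_zero_of_isCoprime h𝔣 hb hcop hle)
  have hfin : (Function.mulSupport fun v : HeightOneSpectrum (𝓞 K) => primaryGen hsurj v ^ c v).Finite := by
    refine (Ideal.finite_factors hI0).subset fun v hv => ?_
    rw [Function.mem_mulSupport] at hv
    rw [Set.mem_setOf_eq, ← Associates.count_ne_zero_iff_dvd hI0 v.irreducible]
    intro h0; exact hv (by simp only [hc] at h0 ⊢; rw [h0, pow_zero])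
  -- the span of the product is `(b)`
  let σ : 𝓞 K →* Ideal (𝓞 K) :=
    { toFun := fun x => Ideal.span {x}
      map_one' := by rw [Ideal.span_singleton_one, Ideal.one_eq_top]
      map_mul' := fun x y => (Ideal.span_singleton_mul_span_singleton x y).symm }
  have hspan : Ideal.span {∏ᶠ v : HeightOneSpectrum (𝓞 K), primaryGen hsurj v ^ c v} = I := by
    change σ _ = I
    rw [σ.map_finprod hfin, ← Ideal.finprod_heightOneSpectrum_factorization hI0]
    refine finprod_congr fun v => ?_
    change Ideal.span {primaryGen hsurj v ^ c v} = v.asIdeal ^ c v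
    by_cases h0 : c v = 0
    · rw [h0, pow_zero, pow_zero, Ideal.span_singleton_one, Ideal.one_eq_top]
    · rw [← Ideal.span_singleton_pow, span_primaryGen hsurj (hvf v h0)]
  -- the product is `≡ 1 mod 𝔣`
  have hone : (∏ᶠ v : HeightOneSpectrum (𝓞 K), primaryGen hsurj v ^ c v) - 1 ∈ 𝔣 := by
    rw [← Ideal.Quotient.eq, map_one, map_finprod (Ideal.Quotient.mk 𝔣) hfin]
    refine finprod_eq_one_of_forall_eq_one fun v => ?_
    by_cases h0 : c v = 0
    · rw [h0, pow_zero, map_one]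
    · rw [map_pow, (Ideal.Quotient.eq.mpr (primaryGen_sub_one_mem hsurj (hvf v h0)) :
        Ideal.Quotient.mk 𝔣 (primaryGen hsurj v) = Ideal.Quotient.mk 𝔣 1), map_one, one_pow]
  exact (primarize_eq_of hsurj hinj hcop hspan hone).symm

end Primary

/-! ### The infinity type `(1, 0)` at the place of an embedding -/

section InfinityType

omit [NumberField K] in
/-- The exponent `p` of the infinity type of "`(α) ↦ e(α)`": `1` at the place of `e` if its chosen
embedding is `e`, `0` otherwise. [folklore] -/
def embType (e : K →+* ℂ) (w : InfinitePlace K) : ℤ :=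
  open scoped Classical in if w.embedding = e then 1 else 0

omit [NumberField K] in
/-- The exponent `q` of the infinity type of "`(α) ↦ e(α)`": `1` at the place of `e` if its chosen
embedding is `ē ≠ e`, `0` otherwise. [folklore] -/
def embTypeConj (e : K →+* ℂ) (w : InfinitePlace K) : ℤ :=
  open scoped Classical in
  if w.embedding = e then 0 else if NumberField.ComplexEmbedding.conjugate w.embedding = e then 1 else 0

/-- **`∏_w σ_w(x)^{p_w} \overline{σ_w(x)}^{q_w} = e(x)` for the type `(p, q) = (embType e, embTypeConj e)`**:
only the place `w_e` of `e` contributes, through `σ_{w_e} = e` or `σ̄_{w_e} = e`. [folklore] -/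
theorem prod_embedding_zpow_embType (e : K →+* ℂ) (x : K) :
    ∏ w : InfinitePlace K, w.embedding x ^ embType e w * conj (w.embedding x) ^ embTypeConj e w = e x := by
  classical
  rw [Finset.prod_eq_single (InfinitePlace.mk e)]
  · by_cases h : (InfinitePlace.mk e).embedding = e
    · rw [embType, embTypeConj, if_pos h, if_pos h, zpow_one, zpow_zero, mul_one, h]
    · have h' : NumberField.ComplexEmbedding.conjugate (InfinitePlace.mk e).embedding = e := by
        rcases InfinitePlace.embedding_mk_eq e with h1 | h1
        · exact absurd h1 h
        · rw [h1]; exact star_star e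
      rw [embType, embTypeConj, if_neg h, if_neg h, if_pos h', zpow_zero, zpow_one, one_mul,
        ← NumberField.ComplexEmbedding.conjugate_coe_eq, h']
  · intro w _ hw
    have h1 : w.embedding ≠ e := fun h => hw (by rw [← h, InfinitePlace.mk_embedding])
    have h2 : NumberField.ComplexEmbedding.conjugate w.embedding ≠ e := fun h =>
      hw (by rw [← h, InfinitePlace.mk_conjugate_eq, InfinitePlace.mk_embedding])
    rw [embType, embTypeConj, if_neg h1, if_neg h1, if_neg h2, zpow_zero, zpow_zero, mul_one]
  · intro h; exact absurd (Finset.mem_univ _) h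

end InfinityType

/-! ### The Größencharakter `𝔭 ↦ e(ϖ_𝔭)` and its Hecke character -/

section Character

variable {𝔣 : Ideal (𝓞 K)} [IsPrincipalIdealRing (𝓞 K)]
variable (hsurj : ∀ x : 𝓞 K, IsCoprime (Ideal.span {x}) 𝔣 → ∃ u : (𝓞 K)ˣ, (u : 𝓞 K) * x - 1 ∈ 𝔣)
variable (hinj : ∀ u : (𝓞 K)ˣ, (u : 𝓞 K) - 1 ∈ 𝔣 → u = 1)
include hsurj hinj

/-- **The ideal character of primary generators**: for a nonzero integer `b` prime to `𝔣`,
`∏_𝔭 e(ϖ_𝔭)^{ν_𝔭((b))} = e(primarize b)`. [folklore] -/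
theorem idealPow_primaryGen_span (h𝔣 : 𝔣 ≠ ⊥) (e : K →+* ℂ) {b : 𝓞 K} (hb : b ≠ 0)
    (hcop : IsCoprime (Ideal.span {b}) 𝔣) :
    LFunctions.idealPow K (fun v => e (primaryGen hsurj v)) (Ideal.span {b}) = e (primarize hsurj b) := by
  rw [← finprod_primaryGen_pow_count hsurj hinj h𝔣 hb hcop, LFunctions.idealPow]
  have hfin : (Function.mulSupport fun v : HeightOneSpectrum (𝓞 K) => primaryGen hsurj v ^
      (Associates.mk v.asIdeal).count (Associates.mk (Ideal.span {b} : Ideal (𝓞 K))).factors).Finite := by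
    refine (Ideal.finite_factors ((Submodule.ne_bot_iff _).mpr ⟨b, Ideal.mem_span_singleton_self b, hb⟩)).subset
      fun v hv => ?_
    rw [Function.mem_mulSupport] at hv
    rw [Set.mem_setOf_eq, ← Associates.count_ne_zero_iff_dvd
      ((Submodule.ne_bot_iff _).mpr ⟨b, Ideal.mem_span_singleton_self b, hb⟩) v.irreducible]
    intro h0; exact hv (by rw [h0, pow_zero])
  have hfin' : (Function.mulSupport fun v : HeightOneSpectrum (𝓞 K) => algebraMap (𝓞 K) K (primaryGen hsurj v ^
      (Associates.mk v.asIdeal).count (Associates.mk (Ideal.span {b} : Ideal (𝓞 K))).factors)).Finite := by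
    refine hfin.subset fun v hv => ?_
    rw [Function.mem_mulSupport] at hv ⊢
    intro h1; exact hv (by rw [h1, map_one])
  rw [show ((∏ᶠ v : HeightOneSpectrum (𝓞 K), primaryGen hsurj v ^
      (Associates.mk v.asIdeal).count (Associates.mk (Ideal.span {b} : Ideal (𝓞 K))).factors : 𝓞 K) : K) =
      algebraMap (𝓞 K) K _ from rfl, map_finprod (algebraMap (𝓞 K) K) hfin, map_finprod e hfin']
  exact finprod_congr fun v => by rw [map_pow, map_pow]

/-- **`𝔭 ↦ e(ϖ_𝔭)` is a Größencharakter `mod 𝔣` of infinity type `(embType e, embTypeConj e)`**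
(`χ̃((b)) = e(primarize b)`; for `b ≡ c mod 𝔣` one unit primarises both, so
`χ̃((b))/χ̃((c)) = e(b/c)`).  Classical instances: the Jacobi-sum / CM Größencharaktere of
`ℚ(ω)` mod `(3)` (Fermat cubic, Picard curves) and of `ℚ(i)` mod `(2+2i)` (`y² = x³ - x`),
Ireland–Rosen, *A Classical Introduction to Modern Number Theory*, Ch. 18 §§4–6; Weil 1952.
[cite: IrelandRosen1982, Ch. 18 §4 (the Hecke character `χ((α)) = α` for primary `α`)] -/
theorem isGrossencharakter_primaryGen (h𝔣 : 𝔣 ≠ ⊥) (e : K →+* ℂ) :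
    IsGrossencharakter 𝔣 (embType e) (embTypeConj e) (fun v => (e (primaryGen hsurj v) : ℂ)) := by
  refine ⟨fun v hv => (map_ne_zero e).mpr ?_, fun b c hb hc hcop hbc _ => ?_⟩
  · exact fun h => primaryGen_ne_zero hsurj hv (by exact_mod_cast h)
  · have hbcop : IsCoprime (Ideal.span {b}) 𝔣 := LFunctions.isCoprime_span_of_sub_mem hcop hbc
    rw [idealPow_primaryGen_span hsurj hinj h𝔣 e hb hbcop, idealPow_primaryGen_span hsurj hinj h𝔣 e hc hcop,
      prod_embedding_zpow_embType, map_div₀]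
    have hc' : (e c : ℂ) ≠ 0 := (map_ne_zero e).mpr fun h => hc (by exact_mod_cast h)
    have key : (primarize hsurj b : K) * c = primarize hsurj c * b := by
      exact_mod_cast primarize_mul_eq_primarize_mul hsurj hinj hcop hbc
    rw [mul_div_assoc', eq_div_iff hc', ← map_mul e, ← map_mul e, key]

/-- **The algebraic Hecke character of primary generators.**  Let `K` be a number field whose ring
of integers is principal and `𝔣 ≠ 0` an ideal such that every residue class prime to `𝔣` contains
exactly one unit (`hsurj`, `hinj`).  For every embedding `e : K → ℂ` there is an algebraic Hecke
character `ψ` of `K`, unramified at every `𝔭 ∤ 𝔣`, with `ψ(ϖ_𝔭) = e(ϖ_𝔭)` for the primary generator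
`ϖ_𝔭 ≡ 1 mod 𝔣` of `𝔭` (`primaryGen`); its infinity type is `(embType e, embTypeConj e)`, i.e.
`ψ((x,1)) = e_w(x_w)⁻¹` at the place `w` of `e` near `1`.  For `K = ℚ(ω)`, `𝔣 = (3)` this is the
Größencharakter `χ((α)) = α` (`α` primary) of Ireland–Rosen Ch. 18 §4, the CM character of the Fermat
cubic and of the Picard curves `y³ = f(x)`; existence of the idelic character is Weil 1956 §1 /
Neukirch VII (6.14) (`HeckeCharacter.exists_of_isGrossencharakter`).
[cite: IrelandRosen1982, Ch. 18 §4] [cite: Weil1956, §1] -/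
theorem exists_heckeCharacter_primaryGen (h𝔣 : 𝔣 ≠ ⊥) (e : K →+* ℂ) :
    ∃ ψ : HeckeCharacter K, ψ.HasInfinityType (embType e) (embTypeConj e) ∧
      ∀ v : HeightOneSpectrum (𝓞 K), ¬ 𝔣 ≤ v.asIdeal →
        ψ.IsUnramifiedAt v ∧ ψ.valueAtUniformizer v = e (primaryGen hsurj v) :=
  HeckeCharacter.exists_of_isGrossencharakter h𝔣 (isGrossencharakter_primaryGen hsurj hinj h𝔣 e)

end Character

end Literature.NumberTheory.GaloisRepresentations

end
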